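import Summits.BirchSwinnertonDyer.Rank1Residual.X2.ClassClosureOfDatum
import Summits.BirchSwinnertonDyer.Rank1Residual.X2.TrivialZeroStrictInclusionDerived
import HarnessLib

/-!
# The X2 terms of record with the trivial-zero record A137 ("`S_{E[p^∞]}(ℚ_∞)` is actually bigger")
# DISCHARGED: `X2.TargetA` from SEVENTEEN registered facts, Mazur's main conjecture at every odd
# multiplicative GV-parity pair, the class theorem and the per-pair form

HONEST FRAMING (BSD rank-`≤ 1` residual cell `b2b-bsdres`, home
`run/shared/lean/b2b/bsd-rank1-residual/`, unit `b2b-bsdres-eisenstein-p2`, class X2 = odd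
multiplicative Eisenstein primes; research route, no claim beyond stated classes; nothing booked;
labels are the referee's): the cell deletes the COMBINATION-SHAPED residual classes of the
rank-`≤ 1` BSD formula from PUBLISHED theorems only and TYPES the construction-shaped ones; this is
not "finishing BSD". THEOREMS ONLY (no definition, no named fact, nothing asserted). Bookkeeping
compositions, nothing re-proved:

* gen 27's `TrivialZeroStrictInclusionDerived.datumStrictSelmer_lt_datumSelmer_of_split_of_relIndex :
  A40 → A137′ → A137` (uniqueness of the Tate line at a split prime + cotorsion from `S_A[p]`
  finite) is fed into the binder `hF` of every X2 closure term, next to gen 26's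
  `lambda_nonPrimitive_eq_add_sum_delta_multiplicative_of_datum : T-GV23L → A40 → A41 → A137′ → A133`
  for the binder `hA`;
* **`targetA_of_derivedTrivialZero_heightFree : X2.TargetA` from SEVENTEEN registered facts** —
  `h23` T-GV23L (`datumSelmer_nonPrimitive_invariants`), `hInf` A137′, `hT`/`hT'` A40/A41, `hB` A135,
  `hLiftF` A195, `hP` A180, `h311` A226 (F1), `hC`/`hD` A224/A225 (F2/F3), `hWu` A33, `hJs`/`hJn`
  A37 (Stein–Wuthrich Thm. 6.1), `hGZK` A18, `hmod` + `hpar` A19, `hGS` Greenberg–Stevens — gen 26's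
  `ClassClosureOfDatum.targetA_of_datum_heightFree` (18 binders) minus `hF`;
* `mazurMainConjectureAt_of_gvPar_of_derivedTrivialZero` (11 facts),
  `target_of_derivedTrivialZero_of_residues` (the class theorem modulo the named X2b/X2c residues),
  `bsdp_of_classX2_of_gvPar_of_derivedTrivialZero` (per pair).

Registry consequence (for the cell's literature seat): A137 ↦ DERIVED ⇐ {A137′, A40}; the X2a
closure term's registered inputs are now T-GV23L, A137′, A40, A41, A135, A195, A180, A226, A224,
A225, A33, A37 (×2), A18, A19 (+ parametrisation), `greenberg_stevens`.

References: GV 2000 Thm. (1.3), §1 pp. 14–15, §2 Prop. (2.1) (p. 17, proof p. 20), Cor. (2.3),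
Prop. (2.4), pp. 25–26, §3 Thm. (3.11); Silverman *ATAEC* V.3.1/V.5.3; Wuthrich 2014 Thm. 16;
Stein–Wuthrich 2013 Thm. 6.1; HOME/b2b-bsdres-eisenstein-p2/X2-GAP.md §32.
-/

noncomputable section

open scoped Classical AddSubgroup MatrixGroups ModularForm

namespace Summit.BirchSwinnertonDyer.Rank1Residual.X2.ClassClosureOfDerivedTrivialZero

open PowerSeries NumberField IsDedekindDomain Field WeierstrassCurve CongruenceSubgroup
  Literature.NumberTheory.EllipticCurves Literature.NumberTheory.EllipticCurves.GreenbergVatsal2000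
  Literature.NumberTheory.EllipticCurves.ModularForms
  Literature.NumberTheory.EllipticCurves.Rank1Residual
  Literature.NumberTheory.EllipticCurves.Rank1Residual.Typed
  Literature.NumberTheory.EllipticCurves.Greenberg1999
  Literature.NumberTheory.EllipticCurves.Wuthrich2014
  Literature.NumberTheory.EllipticCurves.SteinWuthrich2013
  Literature.NumberTheory.EllipticCurves.Disegni2020
  Summit.BirchSwinnertonDyer.Rank1Residual.X2.GreenbergVatsalInputsOfFacts
  Summit.BirchSwinnertonDyer.Rank1Residual.X2.ClassClosureOfDerivedF0
  Summit.BirchSwinnertonDyer.Rank1Residual.X2.ClassClosureOfDatum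
  Summit.BirchSwinnertonDyer.Rank1Residual.X2.NonPrimitiveLambdaInvariantMultiplicativeDerived
  Summit.BirchSwinnertonDyer.Rank1Residual.X2.TrivialZeroStrictInclusionDerived

/-- **Mazur's main conjecture at every odd multiplicative pair of GV parity from registered facts
with A133 AND A137 discharged** (eleven facts: T-GV23L, A137′, A40, A41, A135, A195, A180, A226,
A224, A225, A33): gen 24's `mazurMainConjectureAt_of_gvPar_of_derivedF0` with
`hA := lambda_nonPrimitive_eq_add_sum_delta_multiplicative_of_datum h23 hT hT' hInf` and
`hF := datumStrictSelmer_lt_datumSelmer_of_split_of_relIndex hT hInf`. Bookkeeping.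
[cite: GreenbergVatsal2000, Thm. (1.3) with §1 pp. 14–15, §2 Prop. (2.1), Cor. (2.3), Prop. (2.4), pp. 28–30, §3 Thm. (3.11), Cor. (3.8)]
[cite: Wuthrich2014, Thm. 16 (p. 397)] -/
theorem mazurMainConjectureAt_of_gvPar_of_derivedTrivialZero
    (h23 : datumSelmer_nonPrimitive_invariants)
    (hInf : datumStrictSelmer_relIndex_eq_zero_of_split)
    (hT : Silverman1994_thmV53_tateUniformisation.{0})
    (hT' : Silverman1994_thmV53_corV54_tateUniformisation.{0})
    (hB : datumSelmer_divisible_of_finite_torsionBy)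
    (hLiftF : residualEpsilon_surjOn_of_lineRamifiedEven)
    (hP : cor38_realPeriodRat_eq_unit_mul_of_isIsogenous_of_gvPar)
    (h311 : thm311_hasUnitContent_iff_and_order_eq_of_lineRamifiedEven)
    (hC : characterLFunctionC_hasUnitContent_and_order_eq_card)
    (hD : characterLFunctionD_hasUnitContent_and_order_eq_card)
    (hWu : thm16_charIdeal_dvd_multiplicative_of_reducible)
    (W : WeierstrassCurve ℚ) [W.IsElliptic] [W.IsGloballyMinimal] (p : ℕ) [Fact p.Prime]
    (hp : p ≠ 2) (hmult : W.HasMultiplicativeReductionAtPrime p) (hgv : GVPar W p) :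
    MazurMainConjectureAt W p :=
  mazurMainConjectureAt_of_gvPar_of_derivedF0 hT hT'
    (lambda_nonPrimitive_eq_add_sum_delta_multiplicative_of_datum h23 hT hT' hInf) hB
    (datumStrictSelmer_lt_datumSelmer_of_split_of_relIndex hT hInf) hLiftF hP h311 hC hD hWu W p hp
    hmult hgv

/-- **`X2.TargetA` (sub-cell X2a: `r_an = 0 ∧ GVPar`, every odd `p ‖ N`) from SEVENTEEN registered
facts** — gen 26's `targetA_of_datum_heightFree` with its binder `hF` (A137) supplied by
`datumStrictSelmer_lt_datumSelmer_of_split_of_relIndex hT hInf`. The X2a closure term of record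
after gen 27. Bookkeeping.
[cite: GreenbergVatsal2000, Thm. (1.3) with pp. 1, 14–15; §2 Prop. (2.1), Cor. (2.3), Prop. (2.4); §3 Thm. (3.11)]
[cite: Wuthrich2014, Thm. 16 (p. 397)] [cite: SteinWuthrich2013, Thm. 6.1 (p. 20)] -/
theorem targetA_of_derivedTrivialZero_heightFree
    (h23 : datumSelmer_nonPrimitive_invariants)
    (hInf : datumStrictSelmer_relIndex_eq_zero_of_split)
    (hT : Silverman1994_thmV53_tateUniformisation.{0})
    (hT' : Silverman1994_thmV53_corV54_tateUniformisation.{0})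
    (hB : datumSelmer_divisible_of_finite_torsionBy)
    (hLiftF : residualEpsilon_surjOn_of_lineRamifiedEven)
    (hP : cor38_realPeriodRat_eq_unit_mul_of_isIsogenous_of_gvPar)
    (h311 : thm311_hasUnitContent_iff_and_order_eq_of_lineRamifiedEven)
    (hC : characterLFunctionC_hasUnitContent_and_order_eq_card)
    (hD : characterLFunctionD_hasUnitContent_and_order_eq_card)
    (hWu : thm16_charIdeal_dvd_multiplicative_of_reducible)
    (hJs : thm61_splitMultiplicative) (hJn : thm61_nonsplitMultiplicative)
    (hGZK : rank_eq_analyticRank_of_analyticRank_le_one) (hmod : hasEntireLFunction_rat)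
    (hpar : nonempty_modularParametrizationData)
    (hGS : ∀ (W : WeierstrassCurve ℚ) [W.IsElliptic] [W.IsGloballyMinimal] (p : ℕ) [Fact p.Prime],
      greenberg_stevens (W := W) (p := p)) :
    TargetA :=
  targetA_of_datum_heightFree h23 hInf hT hT' hB
    (datumStrictSelmer_lt_datumSelmer_of_split_of_relIndex hT hInf) hLiftF hP h311 hC hD hWu hJs hJn
    hGZK hmod hpar hGS

/-- **The X2 class theorem `X2.Target` modulo the named X2b / X2c residues, with A133 and A137
discharged** — gen 24's `target_of_derivedF0_of_residues` with `hA`, `hF` supplied from T-GV23L,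
A137′, A40, A41. Bookkeeping.
[cite: GreenbergVatsal2000, Thm. (1.3) with §1 pp. 14–15, §2 Prop. (2.1), Cor. (2.3), Prop. (2.4), §3 Thm. (3.11)]
[cite: Wuthrich2014, Thm. 16 (p. 397)] [cite: SteinWuthrich2013, Thm. 6.1 (p. 20), §4.2]
[cite: Disegni2020, Thm. 4 (§3.2)] -/
theorem target_of_derivedTrivialZero_of_residues
    (h23 : datumSelmer_nonPrimitive_invariants)
    (hInf : datumStrictSelmer_relIndex_eq_zero_of_split)
    (hT : Silverman1994_thmV53_tateUniformisation.{0})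
    (hT' : Silverman1994_thmV53_corV54_tateUniformisation.{0})
    (hB : datumSelmer_divisible_of_finite_torsionBy)
    (hLiftF : residualEpsilon_surjOn_of_lineRamifiedEven)
    (hP : cor38_realPeriodRat_eq_unit_mul_of_isIsogenous_of_gvPar)
    (h311 : thm311_hasUnitContent_iff_and_order_eq_of_lineRamifiedEven)
    (hC : characterLFunctionC_hasUnitContent_and_order_eq_card)
    (hD : characterLFunctionD_hasUnitContent_and_order_eq_card)
    (hWu : thm16_charIdeal_dvd_multiplicative_of_reducible)
    (hJs : thm61_splitMultiplicative) (hJn : thm61_nonsplitMultiplicative)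
    (hHs : exists_isSplitMultCanonical) (hHn : exists_isMultCanonical)
    (hGZ : GrossZagier1986_thm_I_7_3) (hGZK : rank_eq_analyticRank_of_analyticRank_le_one)
    (hmod : hasEntireLFunction_rat) (hpar : nonempty_modularParametrizationData)
    (hGS : ∀ (W : WeierstrassCurve ℚ) [W.IsElliptic] [W.IsGloballyMinimal] (p : ℕ) [Fact p.Prime],
      greenberg_stevens (W := W) (p := p))
    (hDis : padicBSD_rankOne_nonsplitMult)
    (hResB : ∀ (W : WeierstrassCurve ℚ) [W.IsElliptic] [W.IsGloballyMinimal] (p : ℕ) [Fact p.Prime],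
      CellB W p → MazurMainConjectureAt W p)
    (hResCns : ∀ (W : WeierstrassCurve ℚ) [W.IsElliptic] [W.IsGloballyMinimal] (p : ℕ) [Fact p.Prime],
      CellC W p → ¬ W.HasSplitMultiplicativeReductionAtPrime p →
        (GVPar W p ∨ MazurMainConjectureAt W p) ∧
        ∀ (q : ℚ_[p]) (Dh : PAdicHeightData W p), q ≠ 0 → ‖q‖ < 1 → tateJ q = (W.j : ℚ_[p]) →
          IsMultCanonical Dh q → SchneiderConjecture Dh)
    (hResCs : ∀ (W : WeierstrassCurve ℚ) [W.IsElliptic] [W.IsGloballyMinimal] (p : ℕ) [Fact p.Prime],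
      CellC W p → W.HasSplitMultiplicativeReductionAtPrime p →
        (GVPar W p ∨ MazurMainConjectureAt W p) ∧ O9.ExceptionalLeadingTermAt W p ∧
        ∀ (Dq : TateParameterData W p) (Dh : PAdicHeightData W p),
          IsSplitMultCanonical Dh Dq → SchneiderConjecture Dh) :
    Target :=
  target_of_derivedF0_of_residues hT hT'
    (lambda_nonPrimitive_eq_add_sum_delta_multiplicative_of_datum h23 hT hT' hInf) hB
    (datumStrictSelmer_lt_datumSelmer_of_split_of_relIndex hT hInf) hLiftF hP h311 hC hD hWu hJs hJn
    hHs hHn hGZ hGZK hmod hpar hGS hDis hResB hResCns hResCs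

/-- **X2 per pair at GV parity: `BSD(E,p)` with A133 and A137 discharged** — gen 24's
`bsdp_of_classX2_of_gvPar_of_derivedF0` re-threaded; residues only at rank one (non-split: Schneider
certificate; split: `O9.ExceptionalLeadingTermAt` ∧ Schneider). Bookkeeping.
[cite: GreenbergVatsal2000, Thm. (1.3) with §1 pp. 14–15, §2 Prop. (2.1), pp. 28–30, §3 Thm. (3.11), Cor. (3.8)]
[cite: Disegni2020, Thm. 4 (§3.2)] [cite: Wuthrich2014, Thm. 16 (p. 397)] -/
theorem bsdp_of_classX2_of_gvPar_of_derivedTrivialZero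
    (h23 : datumSelmer_nonPrimitive_invariants)
    (hInf : datumStrictSelmer_relIndex_eq_zero_of_split)
    (hT : Silverman1994_thmV53_tateUniformisation.{0})
    (hT' : Silverman1994_thmV53_corV54_tateUniformisation.{0})
    (hB : datumSelmer_divisible_of_finite_torsionBy)
    (hLiftF : residualEpsilon_surjOn_of_lineRamifiedEven)
    (hP : cor38_realPeriodRat_eq_unit_mul_of_isIsogenous_of_gvPar)
    (h311 : thm311_hasUnitContent_iff_and_order_eq_of_lineRamifiedEven)
    (hC : characterLFunctionC_hasUnitContent_and_order_eq_card)
    (hD : characterLFunctionD_hasUnitContent_and_order_eq_card)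
    (hWu : thm16_charIdeal_dvd_multiplicative_of_reducible)
    (hJs : thm61_splitMultiplicative) (hJn : thm61_nonsplitMultiplicative)
    (hHs : exists_isSplitMultCanonical) (hHn : exists_isMultCanonical)
    (hGZ : GrossZagier1986_thm_I_7_3) (hGZK : rank_eq_analyticRank_of_analyticRank_le_one)
    (hmod : hasEntireLFunction_rat) (hpar : nonempty_modularParametrizationData)
    (W : WeierstrassCurve ℚ) [W.IsElliptic] [W.IsGloballyMinimal] (p : ℕ) [Fact p.Prime]
    (hGS : greenberg_stevens (W := W) (p := p)) (hDis : padicBSD_rankOne_nonsplitMult)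
    (hr : W.analyticRank ≤ 1) (hX : ClassX2 W p) (hgv : GVPar W p)
    (hSchNs : W.analyticRank = 1 → ¬ W.HasSplitMultiplicativeReductionAtPrime p →
      ∀ (q : ℚ_[p]) (Dh : PAdicHeightData W p), q ≠ 0 → ‖q‖ < 1 → tateJ q = (W.j : ℚ_[p]) →
        IsMultCanonical Dh q → SchneiderConjecture Dh)
    (hExcS : W.analyticRank = 1 → W.HasSplitMultiplicativeReductionAtPrime p →
      O9.ExceptionalLeadingTermAt W p ∧
      ∀ (Dq : TateParameterData W p) (Dh : PAdicHeightData W p),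
        IsSplitMultCanonical Dh Dq → SchneiderConjecture Dh) :
    BSDp W p :=
  bsdp_of_classX2_of_gvPar_of_derivedF0 hT hT'
    (lambda_nonPrimitive_eq_add_sum_delta_multiplicative_of_datum h23 hT hT' hInf) hB
    (datumStrictSelmer_lt_datumSelmer_of_split_of_relIndex hT hInf) hLiftF hP h311 hC hD hWu hJs hJn
    hHs hHn hGZ hGZK hmod hpar W p hGS hDis hr hX hgv hSchNs hExcS

end Summit.BirchSwinnertonDyer.Rank1Residual.X2.ClassClosureOfDerivedTrivialZero

end

/-! ## Appended (gen 27): A64 / A63 with A133 and A137 discharged — the Greenberg–Vatsal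
multiplicative clauses consumed by the Partition lane's multiplicative corners -/

noncomputable section

namespace Summit.BirchSwinnertonDyer.Rank1Residual.X2.ClassClosureOfDerivedTrivialZero

open Literature.NumberTheory.EllipticCurves Literature.NumberTheory.EllipticCurves.GreenbergVatsal2000
  Literature.NumberTheory.EllipticCurves.Wuthrich2014
  Summit.BirchSwinnertonDyer.Rank1Residual.X2.ClassClosureOfDerivedF0
  Summit.BirchSwinnertonDyer.Rank1Residual.X2.NonPrimitiveLambdaInvariantMultiplicativeDerived
  Summit.BirchSwinnertonDyer.Rank1Residual.X2.TrivialZeroStrictInclusionDerived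

/-- **A64 = `GreenbergVatsal2000.lambda_muAnal_multiplicative_of_gvPar` from TEN registered facts
with A133 and A137 discharged** {T-GV23L, A137′, A40, A41, A135, A195, A180, A226, A224, A225}:
gen 24's `lambda_muAnal_multiplicative_of_gvPar_of_derivedF0` with `hA`, `hF` fed from the datum /
trivial-zero records. Bookkeeping.
[cite: GreenbergVatsal2000, Thm. (1.3), §1 pp. 14–15, §2 (16), Prop. (2.1), pp. 28–30, §3 Thm. (3.11), (28), pp. 41–43, Cor. (3.8)] -/
theorem lambda_muAnal_multiplicative_of_gvPar_of_derivedTrivialZero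
    (h23 : datumSelmer_nonPrimitive_invariants)
    (hInf : datumStrictSelmer_relIndex_eq_zero_of_split)
    (hT : Silverman1994_thmV53_tateUniformisation.{0})
    (hT' : Silverman1994_thmV53_corV54_tateUniformisation.{0})
    (hB : datumSelmer_divisible_of_finite_torsionBy)
    (hLiftF : residualEpsilon_surjOn_of_lineRamifiedEven)
    (hP : cor38_realPeriodRat_eq_unit_mul_of_isIsogenous_of_gvPar)
    (h311 : thm311_hasUnitContent_iff_and_order_eq_of_lineRamifiedEven)
    (hC : characterLFunctionC_hasUnitContent_and_order_eq_card)
    (hD : characterLFunctionD_hasUnitContent_and_order_eq_card) :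
    lambda_muAnal_multiplicative_of_gvPar :=
  lambda_muAnal_multiplicative_of_gvPar_of_derivedF0 hT hT'
    (lambda_nonPrimitive_eq_add_sum_delta_multiplicative_of_datum h23 hT hT' hInf) hB
    (datumStrictSelmer_lt_datumSelmer_of_split_of_relIndex hT hInf) hLiftF hP h311 hC hD

/-- **A63 = `GreenbergVatsal2000.lambdaMu_multiplicative_of_gvPar` from ELEVEN registered facts
with A133 and A137 discharged** (+ Wuthrich 2014 Thm. 16, `hWu`) — the multiplicative
Greenberg–Vatsal clause consumed by `Partition/CornersMult*`. Bookkeeping.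
[cite: GreenbergVatsal2000, Thm. (1.3), §1 pp. 14–15, §2 (16), Prop. (2.1), pp. 28–30, §3 Thm. (3.11), (28), pp. 41–43, Cor. (3.8)]
[cite: Wuthrich2014, Thm. 16 (p. 397)] -/
theorem lambdaMu_multiplicative_of_gvPar_of_derivedTrivialZero
    (h23 : datumSelmer_nonPrimitive_invariants)
    (hInf : datumStrictSelmer_relIndex_eq_zero_of_split)
    (hT : Silverman1994_thmV53_tateUniformisation.{0})
    (hT' : Silverman1994_thmV53_corV54_tateUniformisation.{0})
    (hB : datumSelmer_divisible_of_finite_torsionBy)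
    (hLiftF : residualEpsilon_surjOn_of_lineRamifiedEven)
    (hP : cor38_realPeriodRat_eq_unit_mul_of_isIsogenous_of_gvPar)
    (h311 : thm311_hasUnitContent_iff_and_order_eq_of_lineRamifiedEven)
    (hC : characterLFunctionC_hasUnitContent_and_order_eq_card)
    (hD : characterLFunctionD_hasUnitContent_and_order_eq_card)
    (hWu : thm16_charIdeal_dvd_multiplicative_of_reducible) :
    lambdaMu_multiplicative_of_gvPar :=
  lambdaMu_multiplicative_of_gvPar_of_derivedF0 hT hT'
    (lambda_nonPrimitive_eq_add_sum_delta_multiplicative_of_datum h23 hT hT' hInf) hB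
    (datumStrictSelmer_lt_datumSelmer_of_split_of_relIndex hT hInf) hLiftF hP h311 hC hD hWu

end Summit.BirchSwinnertonDyer.Rank1Residual.X2.ClassClosureOfDerivedTrivialZero

end
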